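import Literature.Computability.Cryptography.ShiftSamplingBlock
import Literature.Computability.Cryptography.PeriodFindingUnits
import Literature.Computability.QuantumComplexity.CoinFamilyKernel
import HarnessLib

/-!
# Fourier sampling of a computed table by eigenvalue estimation of shifts, II: the family and its law

Topic `Computability/Cryptography`; sequel of `ShiftSamplingBlock.lean` (the compiled block `VB` of
the shift experiment for a polynomial-time table `tab x : ℕ → {0,1}*`, its semantics
`VB_mulVec_basisState` and the fibre lemma `resOf_eq_iff`). Here the quantum core of Hallgren's
algorithm for the table `tab` is assembled as a `QCircuitFamily` — on inputs of length `n` the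
sandwich circuit `H_{y,Z}; V_B; S³; H_y` of `PeriodFindingCircuit.lean` around the block — and its
read-out law is derived from `PeriodFindingUnits.sandwich_law_struct` (Kitaev 1995, §3: eigenvalue
estimation of the shift `|v⟩ ↦ |v + 1⟩` on the level sets of the table; Jozsa 2003, §10, proof of
Thm. 6: "Construct the state `(1/√q) ∑ |m⟩|f(m)⟩` … apply the quantum Fourier transform").
Theorem-and-definition file, no named facts; the layout lemmas follow `PeriodFindingFamily.lean`.

* the layouts `eK`, `eCtl` (control `j ↦` (unit, level, type, repetition)), `un`, `lev`, `famσ`,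
  and `zvEquiv` (the offset register as `∏_u [0, 2^L)`, no junk); the identities
  `trialExp_eq_aNum` (Kitaev's exponent of a unit is the block's `aNum`), `val_zvEquiv_eq_zNum`,
  **`coinArg_append`** (the block reads the table at `Z_u − A_u(y) mod 2^L`) and
  `resOf_append_eq_iff` (hypothesis `hR` of the law);
* **`family P hbf`** (`family_isOracleFree`) and **`family_law`** / `family_law_str` /
  **`kernelProb_family`**: on the input string `w`, the probability that the measured string has
  its structured control read-out (`readOf`) in `E` is `prob unitLaw E` — the units are independent,
  each following the per-unit law of the table `tab w` (a mixture over characters `c`, weights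
  `corrMass Q (tab w) c / Q²`, of independent Hadamard tests with exact phases `c/Q`).

## References

* R. Jozsa, *Notes on Hallgren's efficient quantum algorithm for solving Pell's equation*,
  arXiv:quant-ph/0302134 (2003), §10 (proof of Thm. 6). [Jozsa2003]
* A. Yu. Kitaev, arXiv:quant-ph/9511026 (1995), §3 (Lemma 8, Lemma 10), §4. [Kitaev1995]
* P. W. Shor, SIAM J. Comput. 26 (1997), §5. [Shor1997]
-/

noncomputable section

namespace Literature.Computability.Cryptography

namespace ShiftSampling

open _root_.Computability Complexity QuantumComplexity QuantumComplexity.RevClean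
  QuantumComplexity.RevSim Kitaev1995 PeriodFinding Matrix Finset

namespace SSParams

variable (P : SSParams) {tab : List Bool → ℕ → List Bool} (hbf : P.blockFn tab ∈ FP) (n : ℕ)

/-! ### The layout of the controls -/

/-- The test of step `s` of a unit: (level, type, repetition). [folklore] -/
def eK : Fin (P.K n) ≃ TIdx (P.Lv n) (P.B n) :=
  finProdFinEquiv.symm.trans (Equiv.prodCongr (Equiv.refl _)
    (finProdFinEquiv.symm.trans (Equiv.prodCongr finTwoEquiv (Equiv.refl _))))

/-- The layout of the control wires: control `j` carries the test `(e j).2` of unit `(e j).1`. [folklore] -/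
def eCtl : Fin (P.k₁ n) ≃ Fin (P.nU n) × TIdx (P.Lv n) (P.B n) :=
  finProdFinEquiv.symm.trans (Equiv.prodCongr (Equiv.refl _) (P.eK n))

/-- The unit of control `j`. [folklore] -/
def un (j : Fin (P.k₁ n)) : Fin (P.nU n) := (P.eCtl n j).1

/-- The level of control `j`. [folklore] -/
def lev (j : Fin (P.k₁ n)) : ℕ := ((P.eCtl n j).2.1 : ℕ)

/-- The type of control `j`: sine test iff `true`. [folklore] -/
def famσ (j : Fin (P.k₁ n)) : Bool := (P.eCtl n j).2.2.1

/-- The level of the control of step `s` is `⌊s / 2B⌋`. [folklore] -/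
theorem val_eK_fst (s : Fin (P.K n)) : ((P.eK n s).1 : ℕ) = (s : ℕ) / (2 * P.B n) := rfl

/-- The control of step `s` of unit `u` sits at `s + K u`. [folklore] -/
theorem val_eCtl_symm (u : Fin (P.nU n)) (τ : TIdx (P.Lv n) (P.B n)) :
    ((P.eCtl n).symm (u, τ) : ℕ) = ((P.eK n).symm τ : ℕ) + P.K n * u := rfl

/-! ### The family -/

/-- **The quantum core of Hallgren's algorithm for the table `tab`**: on inputs of length `n`,
the sandwich circuit `H_{y,Z}; V_B; S³; H_y` around the compiled block. [cite: Jozsa2003, §10 (proof of Thm. 6); Kitaev1995, §3 (Lemma 10)] -/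
def family : QCircuitFamily cliffordT where
  ancillas n := (P.k₁ n + P.k₂ n) + P.mW hbf n
  circ n := sandwich (P.VB hbf n) (P.famσ n)

/-- A sandwich around an oracle-free block is oracle-free. [folklore] -/
theorem sandwich_isOracleFree {n k₁ k₂ m : ℕ} {V : QCircuit cliffordT (n + ((k₁ + k₂) + m))} (hV : V.IsOracleFree)
    (σ : Fin k₁ → Bool) : (sandwich V σ).IsOracleFree := by
  intro g hg
  simp only [sandwich, List.mem_append] at hg
  rcases hg with ((hg | hg) | hg) | hg
  · simp only [hadamardLayer, List.mem_map] at hg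
    obtain ⟨i, -, rfl⟩ := hg; exact hOn_isOracleFree i
  · exact hV g hg
  · exact phaseLayerL_isOracleFree _ _ g hg
  · obtain ⟨i, -, rfl⟩ := List.mem_map.1 hg; exact hOn_isOracleFree i

/-- **The family is oracle-free.** [folklore] -/
theorem family_isOracleFree : (P.family hbf).IsOracleFree := fun n =>
  sandwich_isOracleFree (P.VB_isOracleFree hbf n) _

/-! ### Kitaev's exponent is the block's `aNum` -/

/-- The controls among the coins `y ++ Z` are `y`. [folklore] -/
theorem ysOf_append (y : QReg (P.k₁ n)) (Z : QReg (P.k₂ n)) : P.ysOf (Fin.append y Z) = List.ofFn y := by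
  rw [ysOf, List.ofFn_fin_append, List.take_left' (List.length_ofFn)]

/-- The offsets among the coins `y ++ Z` are `Z`. [folklore] -/
theorem zsOf_append (y : QReg (P.k₁ n)) (Z : QReg (P.k₂ n)) : P.zsOf (Fin.append y Z) = List.ofFn Z := by
  rw [zsOf, List.ofFn_fin_append, List.drop_left' (List.length_ofFn)]

/-- **Kitaev's exponent of unit `u` is the block's `aNum`.** [cite: Kitaev1995, §3 Lemma 10] -/
theorem trialExp_eq_aNum (u : Fin (P.nU n)) (y : QReg (P.k₁ n)) :
    trialExp (P.un n) (P.lev n) u y = P.aNum n (List.ofFn y) u := by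
  classical
  unfold trialExp aNum
  -- reindex the controls by `(unit, step)`
  rw [sum_filter, ← (P.eCtl n).symm.sum_comp, Fintype.sum_prod_type,
    Fintype.sum_eq_single u (fun u' hu' => sum_eq_zero fun τ _ => if_neg (by simpa [un] using hu'))]
  simp only [un, Equiv.apply_symm_apply, if_true]
  rw [← (P.eK n).sum_comp, ← List.sum_toFinset _ List.nodup_range, List.toFinset_range, sum_range]
  refine sum_congr rfl fun s _ => ?_
  have hs := s.isLt
  have hidx : ((P.eCtl n).symm (u, P.eK n s) : ℕ) = P.K n * u + s := by
    rw [val_eCtl_symm, Equiv.symm_apply_apply, Nat.add_comm]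
  have hlev : P.lev n ((P.eCtl n).symm (u, P.eK n s)) = (s : ℕ) / (2 * P.B n) := by
    rw [lev, Equiv.apply_symm_apply, val_eK_fst]
  have hlt : P.K n * u + s < P.k₁ n := by
    have h1 : P.K n * (u + 1) ≤ P.K n * P.nU n := Nat.mul_le_mul_left _ u.isLt
    rw [Nat.mul_succ] at h1
    unfold k₁; rw [Nat.mul_comm (P.nU n)]; omega
  have hmin : min ((s : ℕ) / (2 * P.B n)) (P.Lv n) = (s : ℕ) / (2 * P.B n) := by
    refine min_eq_left ((Nat.div_lt_iff_lt_mul (by have := P.B_pos n; omega)).2 ?_).le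
    unfold K at hs; exact hs
  rw [hlev, hmin, List.getD_eq_getElem _ _ (by simp; exact hlt), List.getElem_ofFn]
  congr 2
  congr 1
  exact Fin.ext hidx

/-! ### The offset register as `∏_u [0, 2^L)` -/

/-- Bit tuples as numbers (little-endian). [folklore] -/
def bitsEquiv (L : ℕ) : (Fin L → Bool) ≃ Fin (2 ^ L) :=
  (Equiv.arrowCongr (Equiv.refl _) finTwoEquiv.symm).trans finFunctionFinEquiv

/-- The number of a bit tuple is its little-endian value. [folklore] -/
theorem val_bitsEquiv {L : ℕ} (f : Fin L → Bool) : (bitsEquiv L f : ℕ) = ∑ i : Fin L, (f i).toNat * 2 ^ (i : ℕ) := by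
  rw [bitsEquiv, Equiv.trans_apply, finFunctionFinEquiv_apply]
  refine sum_congr rfl fun i _ => ?_
  congr 1
  show ((finTwoEquiv.symm (f i) : Fin 2) : ℕ) = (f i).toNat
  cases f i <;> rfl

/-- **The offset register identified with `(∏_u [0, 2^L)) × 1`** (no junk: every offset bit is read).
[folklore] -/
def zvEquiv : QReg (P.k₂ n) ≃ ((u : Fin (P.nU n)) → Fin (Qof (fun _ : Fin (P.nU n) => P.L n) u)) × Unit :=
  (((Equiv.arrowCongr finProdFinEquiv.symm (Equiv.refl Bool)).trans
    ((Equiv.curry _ _ _).trans (Equiv.piCongrRight fun _ => bitsEquiv (P.L n)))).trans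
    (Equiv.prodPUnit _).symm)

/-- The unit component of the offset register is the little-endian value of the unit's bits. [folklore] -/
theorem val_zvEquiv (Z : QReg (P.k₂ n)) (u : Fin (P.nU n)) :
    (((P.zvEquiv n Z).1 u : Fin _) : ℕ) = ∑ i : Fin (P.L n), (Z (finProdFinEquiv (u, i))).toNat * 2 ^ (i : ℕ) := by
  show ((bitsEquiv (P.L n) (fun i => Z (finProdFinEquiv (u, i)))) : ℕ) = _
  rw [val_bitsEquiv]

/-- `bitsToNat (ofFn v)` as a sum (as `ShorFP.bitsToNat_ofFn`, a private copy). [folklore] -/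
private theorem bitsToNat_ofFn' : ∀ {k : ℕ} (v : Fin k → Bool), bitsToNat (List.ofFn v) = ∑ i : Fin k, (v i).toNat * 2 ^ (i : ℕ)
  | 0, v => by simp
  | k + 1, v => by
    rw [List.ofFn_succ, bitsToNat_cons, bitsToNat_ofFn', Fin.sum_univ_succ, mul_sum]
    simp only [Fin.val_zero, pow_zero, mul_one, Fin.val_succ, pow_succ]
    congr 1
    exact sum_congr rfl fun i _ => by ring

/-- `bitsToNat` of a list as a sum over its positions. [folklore] -/
theorem bitsToNat_eq_sum (l : List Bool) : bitsToNat l = ∑ i : Fin l.length, (l.get i).toNat * 2 ^ (i : ℕ) := by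
  conv_lhs => rw [← List.ofFn_get l]
  rw [bitsToNat_ofFn']

/-- **The unit component of the offset register is the block's `zNum`.** [folklore] -/
theorem val_zvEquiv_eq_zNum (Z : QReg (P.k₂ n)) (u : Fin (P.nU n)) :
    (((P.zvEquiv n Z).1 u : Fin _) : ℕ) = P.zNum n (List.ofFn Z) u := by
  rw [val_zvEquiv, zNum, min_eq_left (P.L_mul_le_k₂ u.isLt), bitsToNat_eq_sum]
  set l := ((List.ofFn Z).drop (P.L n * u)).take (P.L n) with hl
  have hLk : P.L n * u + P.L n ≤ P.k₂ n := by
    have h1 : P.L n * (u + 1) ≤ P.L n * P.nU n := Nat.mul_le_mul_left _ u.isLt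
    rw [Nat.mul_succ] at h1
    unfold k₂; rw [Nat.mul_comm (P.nU n)]; exact h1
  have hlen : l.length = P.L n := by
    rw [hl, List.length_take, List.length_drop, List.length_ofFn, min_eq_left (by omega)]
  symm
  refine Fintype.sum_equiv (finCongr hlen) _ _ fun i => ?_
  have hi : (i : ℕ) < P.L n := hlen ▸ i.isLt
  have hget : l.get i = Z (finProdFinEquiv (u, finCongr hlen i)) := by
    rw [List.get_eq_getElem]
    simp only [hl, List.getElem_take, List.getElem_drop, List.getElem_ofFn]
    congr 1
    ext
    simp only [finCongr_apply, Fin.val_cast, finProdFinEquiv_apply_val]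
    omega
  rw [hget]
  simp

/-- **The block's table argument is the shifted offset**: on coins `y ++ Z`, unit `u` reads the
table at `Z_u − A_u(y) (mod 2^L)`. [cite: Kitaev1995, §3 Lemma 10] -/
theorem coinArg_append (y : QReg (P.k₁ n)) (Z : QReg (P.k₂ n)) (u : Fin (P.nU n)) :
    P.coinArg (Fin.append y Z) u =
      shiftMod (Qof (fun _ : Fin (P.nU n) => P.L n) u)
        ((((P.zvEquiv n Z).1 u : Fin _) : ℕ) - (trialExp (P.un n) (P.lev n) u y : ℤ)) := by
  rw [coinArg, ysOf_append, zsOf_append, unitArg_eq_shiftMod, trialExp_eq_aNum, val_zvEquiv_eq_zNum]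
  rfl

/-- **Hypothesis `hR` of the read-out law**: two control strings give the same work register iff
the table takes the same value at every unit's shifted offset. [cite: Kitaev1995, §3 Lemma 10] -/
theorem resOf_append_eq_iff (x : QReg n) (Z : QReg (P.k₂ n)) (y y' : QReg (P.k₁ n)) :
    P.resOf hbf x (Fin.append y Z) = P.resOf hbf x (Fin.append y' Z) ↔
      ∀ u : Fin (P.nU n),
        tab (List.ofFn x) (shiftMod (Qof (fun _ : Fin (P.nU n) => P.L n) u)
          ((((P.zvEquiv n Z).1 u : Fin _) : ℕ) - (trialExp (P.un n) (P.lev n) u y : ℤ))) =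
        tab (List.ofFn x) (shiftMod (Qof (fun _ : Fin (P.nU n) => P.L n) u)
          ((((P.zvEquiv n Z).1 u : Fin _) : ℕ) - (trialExp (P.un n) (P.lev n) u y' : ℤ))) := by
  rw [resOf_eq_iff]
  constructor
  · intro h u
    have := h u u.isLt
    rwa [coinArg_append, coinArg_append] at this
  · intro h u hu
    have := h ⟨u, hu⟩
    rw [show u = ((⟨u, hu⟩ : Fin (P.nU n)) : ℕ) from rfl, coinArg_append, coinArg_append]
    exact this

/-! ### The law of the family -/

/-- **The read-out law of the quantum core**: on input `x` of length `n`, the Born probability that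
the structured control read-out lies in `E` is `prob unitLaw E` — the units are independent, each
following the per-unit law of the table `tab x` (a mixture over characters `c`, weights
`corrMass (tab x) c / Q²`, of independent Hadamard tests with exact phases `c/Q`).
[cite: Kitaev1995, §3 (Lemma 8, Lemma 10) and §4; Jozsa2003, §10 (proof of Thm. 6)] -/
theorem family_law (x : QReg n) (E : Finset (Fin (P.nU n) → TIdx (P.Lv n) (P.B n) → Bool)) :
    ∑ z ∈ univ.filter (fun z : QReg (n + ((P.k₁ n + P.k₂ n) + P.mW hbf n)) =>
        structRead (P.eCtl n) (fun j => z (yWire n (P.k₁ n) (P.k₂ n) (P.mW hbf n) j)) ∈ E),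
        ‖((P.family hbf).circ n).runOn 0 (basisState (padInput x _)) z‖ ^ 2 =
      prob (X := fun _ : Fin (P.nU n) => TIdx (P.Lv n) (P.B n) → Bool)
        (unitLaw (fun _ : Fin (P.nU n) => P.L n) (fun _ => tab (List.ofFn x))) E :=
  sandwich_law_struct (fun _ : Fin (P.nU n) => P.L n) (fun _ => tab (List.ofFn x)) (P.eCtl n)
    (un := P.un n) (lev := P.lev n) (σ := P.famσ n) (fun _ => rfl) (fun _ => rfl) (fun _ => rfl) (P.zvEquiv n) 0
    (P.VB hbf n) x (fun y Z => P.resOf hbf x (Fin.append y Z))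
    (fun y Z => P.VB_mulVec_basisState hbf x (Fin.append y Z))
    (fun Z y y' => P.resOf_append_eq_iff hbf n x Z y y') E

/-! ### The law on output strings -/

/-- The structured read-outs of the quantum core on inputs of length `n`. [folklore] -/
abbrev Readout : Type := Fin (P.nU n) → TIdx (P.Lv n) (P.B n) → Bool

/-- The control bits of an output string of the quantum core on inputs of length `n` (the control
wires are `n, …, n + k₁ − 1`). [folklore] -/
def ctlOf (w : List Bool) : Fin (P.k₁ n) → Bool := fun j => w.getD (n + j) false

/-- The structured read-out of an output string. [folklore] -/
def readOf (w : List Bool) : P.Readout n := structRead (P.eCtl n) (P.ctlOf n w)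

variable {n}

/-- On the read-out of all wires, `ctlOf` reads the control wires. [folklore] -/
theorem ctlOf_ofFn (z : QReg (n + ((P.k₁ n + P.k₂ n) + P.mW hbf n))) :
    P.ctlOf n (List.ofFn z) = fun j => z (yWire n (P.k₁ n) (P.k₂ n) (P.mW hbf n) j) := by
  funext j
  have hlt : n + j < n + ((P.k₁ n + P.k₂ n) + P.mW hbf n) := by have := j.isLt; omega
  have hw : (⟨n + j, hlt⟩ : Fin _) = yWire n (P.k₁ n) (P.k₂ n) (P.mW hbf n) j :=
    Fin.ext (by simp [yWire, val_coinWire])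
  rw [ctlOf, List.getD_eq_getElem?_getD, List.getElem?_ofFn, dif_pos hlt, Option.getD_some, hw]

variable (n)

/-- **The read-out law on output strings**: the Born mass of the outputs whose string read-out lies
in `E` is `prob unitLaw E` (the form matching `toReal_outputPMF_map_ofFn`). [cite: Kitaev1995, §3–§4] -/
theorem family_law_str (x : QReg n) (E : Finset (P.Readout n))
    [DecidablePred (· ∈ {w : List Bool | P.readOf n w ∈ E})] :
    ∑ z : QReg (n + ((P.k₁ n + P.k₂ n) + P.mW hbf n)), (if List.ofFn z ∈ {w : List Bool | P.readOf n w ∈ E} then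
        ‖((P.family hbf).circ n).runOn 0 (basisState (padInput x _)) z‖ ^ 2 else 0) =
      prob (X := fun _ : Fin (P.nU n) => TIdx (P.Lv n) (P.B n) → Bool)
        (unitLaw (fun _ : Fin (P.nU n) => P.L n) (fun _ => tab (List.ofFn x))) E := by
  rw [← P.family_law hbf n x E, sum_filter]
  refine sum_congr rfl fun z _ => ?_
  have hr : List.ofFn z ∈ {w : List Bool | P.readOf n w ∈ E} ↔ structRead (P.eCtl n)
      (fun j => z (yWire n (P.k₁ n) (P.k₂ n) (P.mW hbf n) j)) ∈ E := by
    rw [Set.mem_setOf_eq]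
    unfold readOf
    rw [P.ctlOf_ofFn hbf]
  by_cases h : structRead (P.eCtl n) (fun j => z (yWire n (P.k₁ n) (P.k₂ n) (P.mW hbf n) j)) ∈ E
  · rw [if_pos (hr.2 h), if_pos h]
  · rw [if_neg (fun h' => h (hr.1 h')), if_neg h]

/-- **The kernel of the family**: on the input string `w`, the probability that the measured string
has its read-out in `E` is `prob unitLaw E` for the table `tab w`. [cite: Kitaev1995, §3–§4; Jozsa2003, §10 Thm. 6] -/
theorem kernelProb_family (w : List Bool) (E : Finset (P.Readout w.length)) :
    (P.family hbf).kernelProb 0 w {v : List Bool | P.readOf w.length v ∈ E} =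
      prob (X := fun _ : Fin (P.nU w.length) => TIdx (P.Lv w.length) (P.B w.length) → Bool)
        (unitLaw (fun _ : Fin (P.nU w.length) => P.L w.length) (fun _ => tab w)) E := by
  classical
  rw [QCircuitFamily.kernelProb, QCircuitFamily.kernel, toReal_outputPMF_map_ofFn]
  have h := P.family_law_str hbf w.length w.get E
  rw [List.ofFn_get] at h
  exact h

end SSParams

end ShiftSampling

end Literature.Computability.Cryptography

end
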